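import Mathlib
import Summits.ValiantsHypothesis.ValiantsHypothesis.Theorems.DivisionGapPerCofactorDegreeReductionStubBottomComponentFree
import Summits.ValiantsHypothesis.ValiantsHypothesis.Theorems.PerDivisionHard.Negative.PerLowDegreeRung
import Literature.Computability.AlgebraicComplexity.ValiantClassesProofs
import Literature.Computability.AlgebraicComplexity.ArithCircuitProofs
import Literature.Computability.AlgebraicComplexity.PermanentIrreducible

/-!
# Crux `DivisionGap.PerCofactorDegreeReduction` (stmt-ValiantsHypothesis-15046), line
# `Sketch_ideator4` — stub `stub_coverRung`: the COVER RUNG ("Kőnig board shrinking")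

**Theorem (`stub_coverRung`).** If one monomial `m` of a cofactor `h ∈ ℝ≥0[x_{ij}]` (`n × n`
variables) is supported in the union of the rows `R` and the columns `C`, then
`L⁺(per_{n - |R| - |C|}) ≤ L⁺(per_n · h) + 1` (`L⁺ = complexity` over `ℝ≥0`).

Proof.  `r = |R|`, `c = |C|`.  If `r + c > n` the left side is `L(per_0) = L(1) = 0`.  Otherwise
pick `S ⊇ R ∪ C` with `|S| = r + c`; the square is `Q = Sᶜ` (`|Q| = n - r - c`).  The substitution
`φ` (`x_{ij} ↦ 1` on the cover lines `i ∈ R ∨ j ∈ C`, `↦ X_{ij}` on `Q × Q`, `↦ 0` elsewhere) is a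
Valiant projection.  A permutation SURVIVES it (no cell `(σ j, j)` is sent to `0`) iff it maps the
`r` columns `S ∖ C` into the rows `R` and then (counting) `Q` onto `Q` and `S` onto `S`
(`maps_of_good`); its image is the monomial of its restriction `shrinkPerm S σ` to `Q`, and the
survivors are `Perm Q × F`, `F` = the survivors fixing `Q` pointwise (nonempty: the involution
swapping `S ∖ (R ∪ C)` with `R ∩ C`, `exists_good_fix`), so `per_n ↦ |F| · per_Q`
(`sum_monomial_shrinkPerm_eq_smul`), while `h ↦ h♮` with `h♮(0) ≥ h_m > 0` (the cells of `m` all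
go to `1`; no cancellation over `ℝ≥0`).  The degree-`|Q|` homogeneous component of the image
`|F| · per_Q · h♮` of `per_n · h` is `|F| h♮(0) · per_Q`; bottom components are free over `ℝ≥0`
(`stub_bottomComponentFree`), unscaling costs one gate (`complexity_smul_le`), and `per_Q` is
`per_{n-r-c}` up to renaming along `Q ≃ Fin (n - r - c)`.  No definitions: the substitution, the
survivor set and the fibre enter the lemmas as parameters characterised by hypotheses
(`hφ`, `hG`, `hF`).  Template: `PerDivisionHard/Negative/PerLowDegreeRung.lean`. [folklore] -/

noncomputable section

-- `Summit.ValiantsHypothesis.ValiantsHypothesis.…` is the tree's mandated single-conjunct layout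
-- (Problem = Summit), so the duplicated namespace component is intended.
set_option linter.dupNamespace false

namespace Summit.ValiantsHypothesis.ValiantsHypothesis.Theorems.DivisionGap.PerCofactorDegreeReduction.CoverRung

open MvPolynomial Literature.Computability.AlgebraicComplexity
open Summit.ValiantsHypothesis.ValiantsHypothesis.Theorems.PerDivisionHard.Negative
open Summit.ValiantsHypothesis.ValiantsHypothesis.Theorems.DivisionGap.PerCofactorDegreeReduction.BottomComponentFree
open scoped NNReal

variable {n : ℕ} {R C S : Finset (Fin n)}

/-- The generic permanent is natural under bijections of the index type: this is
`PerDivisionHard.Negative.rename_perPoly` (`PerSupportBound.lean`; deprecated duplicate kept as an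
alias, dedup-03050). [folklore] -/
@[deprecated rename_perPoly (since := "2026-08-17")]
alias rename_prodMap_perPoly_nnreal := rename_perPoly

/-- The degree-`k` homogeneous component of `p * q` with `p` homogeneous of degree `k` is
`p · q(0)`. [folklore] -/
theorem homogeneousComponent_mul_of_isHomogeneous {σ K : Type*} [CommSemiring K]
    {p q : MvPolynomial σ K} {k : ℕ} (hp : p.IsHomogeneous k) :
    homogeneousComponent k (p * q) = p * MvPolynomial.C (coeff 0 q) := by
  conv_lhs => rw [← sum_homogeneousComponent q]
  rw [Finset.mul_sum, map_sum, Finset.sum_eq_single 0]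
  · rw [homogeneousComponent_zero]
    exact homogeneousComponent_eq_self (hp.mul (isHomogeneous_C _ _))
  · intro i _ hi
    rw [homogeneousComponent_of_mem ((mem_homogeneousSubmodule _ _).mpr
      (hp.mul (homogeneousComponent_isHomogeneous i q))), if_neg (by omega)]
  · exact fun h0 => absurd (Finset.mem_range.mpr (Nat.succ_pos _)) h0

/-- Every monomial of `p * q` with `p` homogeneous of degree `k` has degree `≥ k`. [folklore] -/
theorem le_weight_of_mem_support_mul {σ K : Type*} [CommSemiring K] {p q : MvPolynomial σ K}
    {k : ℕ} (hp : p.IsHomogeneous k) {d : σ →₀ ℕ} (hd : d ∈ (p * q).support) :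
    k ≤ Finsupp.weight (1 : σ → ℕ) d := by
  classical
  obtain ⟨a, ha, b, _, rfl⟩ := Finset.mem_add.mp (support_mul p q hd)
  rw [map_add, hp (mem_support_iff.mp ha)]
  exact Nat.le_add_right _ _

/-- The value of the restriction `shrinkPerm S σ` of a permutation mapping `S` into `S`.
[folklore] -/
theorem shrinkPerm_apply_val {σ : Equiv.Perm (Fin n)} (h : ∀ i ∈ S, σ i ∈ S)
    (x : {a : Fin n // a ∉ S}) : ((shrinkPerm S σ x : {a : Fin n // a ∉ S}) : Fin n) = σ x := by
  rw [shrinkPerm, dif_pos h]; rfl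

/-- A SURVIVING permutation (`∀ j, (σ j ∈ R ∨ j ∈ C) ∨ (σ j ∉ S ∧ j ∉ S)`: no cell `(σ j, j)` is
killed) maps the columns `S ∖ C` into the rows `R`, hence (counting, `|S ∖ C| = |R|`) the square
`Sᶜ` into itself and (counting again, `forall_not_mem_iff_of_maps`) `S` into `S`. [folklore] -/
theorem maps_of_good (hCS : C ⊆ S) (hcard : S.card = R.card + C.card) {σ : Equiv.Perm (Fin n)}
    (hσ : ∀ j, (σ j ∈ R ∨ j ∈ C) ∨ (σ j ∉ S ∧ j ∉ S)) : ∀ i ∈ S, σ i ∈ S := by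
  classical
  have ha : ∀ j ∈ S \ C, σ j ∈ R := fun j hj => by
    rw [Finset.mem_sdiff] at hj
    rcases hσ j with (h | h) | h
    exacts [h, absurd h hj.2, absurd hj.1 h.2]
  have himg : (S \ C).image σ = R := by
    refine Finset.eq_of_subset_of_card_le (fun y hy => ?_) ?_
    · obtain ⟨j, hj, rfl⟩ := Finset.mem_image.mp hy
      exact ha j hj
    · rw [Finset.card_image_of_injective _ σ.injective, Finset.card_sdiff_of_subset hCS]
      omega
  have hc : ∀ j ∈ Sᶜ, σ j ∈ Sᶜ := fun j hj => by
    rw [Finset.mem_compl] at hj ⊢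
    intro hσj
    rcases hσ j with (h | h) | h
    · rw [← himg, Finset.mem_image] at h
      obtain ⟨j', hj', hjj'⟩ := h
      obtain rfl : j' = j := σ.injective hjj'
      exact hj (Finset.mem_sdiff.mp hj').1
    · exact hj (hCS h)
    · exact h.1 hσj
  exact fun i hi => Finset.notMem_compl.mp
    ((forall_not_mem_iff_of_maps Sᶜ hc i).mp (Finset.notMem_compl.mpr hi))

/-- Post-composing a surviving permutation with a permutation of the square gives a surviving
permutation. [folklore] -/
theorem good_ofSubtype_mul (hRS : R ⊆ S) (ρ : Equiv.Perm {a : Fin n // a ∉ S})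
    {σ : Equiv.Perm (Fin n)} (hσ : ∀ j, (σ j ∈ R ∨ j ∈ C) ∨ (σ j ∉ S ∧ j ∉ S)) (j : Fin n) :
    ((Equiv.Perm.ofSubtype ρ * σ) j ∈ R ∨ j ∈ C) ∨ ((Equiv.Perm.ofSubtype ρ * σ) j ∉ S ∧ j ∉ S) := by
  rw [Equiv.Perm.mul_apply]
  rcases hσ j with (h | h) | h
  · exact Or.inl (Or.inl (by rwa [Equiv.Perm.ofSubtype_apply_of_not_mem ρ (not_not.mpr (hRS h))]))
  · exact Or.inl (Or.inr h)
  · rw [Equiv.Perm.ofSubtype_apply_of_mem ρ h.1]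
    exact Or.inr ⟨(ρ ⟨σ j, h.1⟩).2, h.2⟩

/-- Restriction to the square is equivariant for post-composition with permutations of the square.
[folklore] -/
theorem shrinkPerm_ofSubtype_mul (ρ : Equiv.Perm {a : Fin n // a ∉ S}) {σ : Equiv.Perm (Fin n)}
    (hS : ∀ i ∈ S, σ i ∈ S) : shrinkPerm S (Equiv.Perm.ofSubtype ρ * σ) = ρ * shrinkPerm S σ := by
  have hS' : ∀ i ∈ S, (Equiv.Perm.ofSubtype ρ * σ) i ∈ S := fun i hi => by
    rw [Equiv.Perm.mul_apply, Equiv.Perm.ofSubtype_apply_of_not_mem ρ (not_not.mpr (hS i hi))]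
    exact hS i hi
  refine Equiv.ext fun x => Subtype.ext ?_
  rw [shrinkPerm_apply_val hS', Equiv.Perm.mul_apply, Equiv.Perm.mul_apply,
    Equiv.Perm.ofSubtype_apply_of_mem ρ ((forall_not_mem_iff_of_maps S hS x.1).mp x.2)]
  congr 2
  exact Subtype.ext (shrinkPerm_apply_val hS x).symm

/-- **The survivors are `Perm Q × F`** (`G` = survivors, `F` = survivors fixing the square `Q = Sᶜ`
pointwise) via `(τ, σ₀) ↦ ofSubtype τ * σ₀`, inverse `σ ↦ (σ|_Q, (ofSubtype σ|_Q)⁻¹ * σ)`; so the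
sum of the monomials of the restrictions of the survivors is `|F| · per_Q`. [folklore] -/
theorem sum_monomial_shrinkPerm_eq_smul (hRS : R ⊆ S) (hCS : C ⊆ S)
    (hcard : S.card = R.card + C.card) {G F : Finset (Equiv.Perm (Fin n))}
    (hG : ∀ σ, σ ∈ G ↔ ∀ j, (σ j ∈ R ∨ j ∈ C) ∨ (σ j ∉ S ∧ j ∉ S))
    (hF : ∀ σ, σ ∈ F ↔ (∀ j, (σ j ∈ R ∨ j ∈ C) ∨ (σ j ∉ S ∧ j ∉ S)) ∧ ∀ x, x ∉ S → σ x = x) :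
    ∑ σ ∈ G, (monomial (permMonomial (shrinkPerm S σ)) (1 : ℝ≥0) :
        MvPolynomial ({a : Fin n // a ∉ S} × {a : Fin n // a ∉ S}) ℝ≥0) =
      (F.card : ℝ≥0) • perPoly {a : Fin n // a ∉ S} ℝ≥0 := by
  classical
  have hrhs : (F.card : ℝ≥0) • perPoly {a : Fin n // a ∉ S} ℝ≥0 =
      ∑ p ∈ (Finset.univ : Finset (Equiv.Perm {a : Fin n // a ∉ S})) ×ˢ F,
        monomial (permMonomial p.1) (1 : ℝ≥0) := by
    rw [Finset.sum_product, perPoly_eq_sum_monomial, Finset.smul_sum]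
    refine Finset.sum_congr rfl fun τ _ => ?_
    dsimp only
    rw [Finset.sum_const, Nat.cast_smul_eq_nsmul]
  rw [hrhs]
  refine Finset.sum_nbij' (fun σ => (shrinkPerm S σ, (Equiv.Perm.ofSubtype (shrinkPerm S σ))⁻¹ * σ))
    (fun p => Equiv.Perm.ofSubtype p.1 * p.2) ?_ ?_ (fun σ _ => mul_inv_cancel_left _ _) ?_
    (fun σ _ => rfl)
  · intro σ hσ
    rw [hG] at hσ
    have hmaps : ∀ i ∈ S, σ i ∈ S := maps_of_good hCS hcard hσ
    simp only [Finset.mem_product, Finset.mem_univ, true_and, hF]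
    refine ⟨?_, fun x hx => ?_⟩
    · rw [← map_inv]
      exact good_ofSubtype_mul hRS _ hσ
    · rw [Equiv.Perm.mul_apply, Equiv.Perm.inv_eq_iff_eq,
        Equiv.Perm.ofSubtype_apply_of_mem (shrinkPerm S σ) hx, shrinkPerm_apply_val hmaps]
  · intro p hp
    simp only [Finset.mem_product, Finset.mem_univ, true_and, hF] at hp
    exact (hG _).mpr (good_ofSubtype_mul hRS _ hp.1)
  · rintro ⟨τ, σ₀⟩ hp
    simp only [Finset.mem_product, Finset.mem_univ, true_and, hF] at hp
    have hmaps₀ : ∀ i ∈ S, σ₀ i ∈ S := maps_of_good hCS hcard hp.1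
    have hone : shrinkPerm S σ₀ = 1 := Equiv.ext fun x => Subtype.ext (by
      rw [shrinkPerm_apply_val hmaps₀]; exact hp.2 x.1 x.2)
    have hshr : shrinkPerm S (Equiv.Perm.ofSubtype τ * σ₀) = τ := by
      rw [shrinkPerm_ofSubtype_mul τ hmaps₀, hone, mul_one]
    simp only [hshr, inv_mul_cancel_left]

/-- **The fibre is nonempty**: the involution swapping `S ∖ (R ∪ C)` with `R ∩ C` (equal
cardinalities) survives and fixes the square pointwise. [folklore] -/
theorem exists_good_fix (hRS : R ⊆ S) (hCS : C ⊆ S) (hcard : S.card = R.card + C.card) :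
    ∃ σ : Equiv.Perm (Fin n),
      (∀ j, (σ j ∈ R ∨ j ∈ C) ∨ (σ j ∉ S ∧ j ∉ S)) ∧ ∀ x, x ∉ S → σ x = x := by
  classical
  have hTI : (S \ (R ∪ C)).card = (R ∩ C).card := by
    have h1 := Finset.card_sdiff_of_subset (Finset.union_subset hRS hCS)
    have h2 := Finset.card_union_add_card_inter R C
    have h3 := Finset.card_le_card (Finset.union_subset hRS hCS)
    omega
  set T := S \ (R ∪ C) with hT
  set I := R ∩ C with hI
  have g : {x // x ∈ T} ≃ {x // x ∈ I} := Fintype.equivOfCardEq (by simp [hTI])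
  have hTI' : ∀ x ∈ T, x ∉ I := fun x hx hxI => by
    rw [hT, Finset.mem_sdiff, Finset.notMem_union] at hx
    exact hx.2.1 (Finset.mem_inter.mp hxI).1
  let f : Fin n → Fin n := fun x =>
    if hx : x ∈ T then (g ⟨x, hx⟩).1 else if hx' : x ∈ I then (g.symm ⟨x, hx'⟩).1 else x
  have hfT : ∀ x (hx : x ∈ T), f x = (g ⟨x, hx⟩).1 := fun x hx => by simp [f, hx]
  have hfI : ∀ x (hx : x ∈ I), f x = (g.symm ⟨x, hx⟩).1 := fun x hx => by
    have hxT : x ∉ T := fun h => hTI' x h hx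
    simp [f, hxT, hx]
  have hfid : ∀ x, x ∉ T → x ∉ I → f x = x := fun x hx hx' => by simp [f, hx, hx']
  have hf : Function.Involutive f := fun x => by
    by_cases hx : x ∈ T
    · rw [hfT x hx, hfI _ (g ⟨x, hx⟩).2]; simp
    by_cases hx' : x ∈ I
    · rw [hfI x hx', hfT _ (g.symm ⟨x, hx'⟩).2]; simp
    rw [hfid x hx hx', hfid x hx hx']
  refine ⟨hf.toPerm f, fun j => ?_, fun x hx => hfid x (fun h => hx (Finset.mem_sdiff.mp h).1)
    (fun h => hx (hRS (Finset.mem_inter.mp h).1))⟩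
  show (f j ∈ R ∨ j ∈ C) ∨ (f j ∉ S ∧ j ∉ S)
  by_cases hj : j ∈ T
  · rw [hfT j hj]; exact Or.inl (Or.inl (Finset.mem_inter.mp (g ⟨j, hj⟩).2).1)
  by_cases hj' : j ∈ I
  · exact Or.inl (Or.inr (Finset.mem_inter.mp hj').2)
  rw [hfid j hj hj']; rw [hT, Finset.mem_sdiff, Finset.notMem_union] at hj; tauto

/-- **`per_n` under the cover substitution `φ`** is the sum, over the survivors, of the monomials
of their restrictions to the square (a killed permutation contributes `0`). [folklore] -/
theorem aeval_perPoly_eq_sum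
    {φ : Fin n × Fin n → MvPolynomial ({a : Fin n // a ∉ S} × {a : Fin n // a ∉ S}) ℝ≥0}
    (hφ : ∀ v, φ v = if v.1 ∈ R ∨ v.2 ∈ C then 1 else
      if h : v.1 ∉ S ∧ v.2 ∉ S then X (⟨v.1, h.1⟩, ⟨v.2, h.2⟩) else 0)
    (hRS : R ⊆ S) (hCS : C ⊆ S) (hcard : S.card = R.card + C.card)
    {G : Finset (Equiv.Perm (Fin n))}
    (hG : ∀ σ, σ ∈ G ↔ ∀ j, (σ j ∈ R ∨ j ∈ C) ∨ (σ j ∉ S ∧ j ∉ S)) :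
    aeval φ (perPoly (Fin n) ℝ≥0) = ∑ σ ∈ G, monomial (permMonomial (shrinkPerm S σ)) (1 : ℝ≥0) := by
  classical
  rw [perPoly_eq_sum_monomial, map_sum, show G = Finset.univ.filter (· ∈ G) by ext; simp,
    Finset.sum_filter]
  refine Finset.sum_congr rfl fun σ _ => ?_
  rw [show (monomial (permMonomial σ) (1 : ℝ≥0) : MvPolynomial _ ℝ≥0) = ∏ i, X (σ i, i) by
    rw [permMonomial, monomial_sum_one]; rfl, map_prod]
  simp only [aeval_X]
  split_ifs with hσ
  · rw [hG] at hσ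
    have hmaps : ∀ i ∈ S, σ i ∈ S := maps_of_good hCS hcard hσ
    rw [permMonomial, monomial_sum_one, ← Fintype.prod_subtype_mul_prod_subtype
      (fun i : Fin n => i ∈ S) (fun i => φ (σ i, i)), Finset.prod_eq_one (fun x _ => ?_), one_mul]
    · refine Fintype.prod_congr _ _ fun x => ?_
      have hx : x.1 ∉ S := x.2
      have hσx : σ x.1 ∉ S := (forall_not_mem_iff_of_maps S hmaps x.1).mp hx
      show φ (σ x.1, x.1) = X (shrinkPerm S σ x, x)
      rw [hφ, if_neg (not_or.mpr ⟨fun h' => hσx (hRS h'), fun h' => hx (hCS h')⟩), dif_pos ⟨hσx, hx⟩]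
      exact congrArg X (Prod.ext (Subtype.ext (shrinkPerm_apply_val hmaps x).symm) rfl)
    · have : σ x.1 ∈ R ∨ x.1 ∈ C := by
        rcases hσ x.1 with h | h
        exacts [h, absurd x.2 h.2]
      show φ (σ x.1, x.1) = 1
      rw [hφ, if_pos this]
  · rw [hG] at hσ
    push Not at hσ
    obtain ⟨j, ⟨hR, hC⟩, hS⟩ := hσ
    apply Finset.prod_eq_zero (Finset.mem_univ j)
    rw [hφ, if_neg (not_or.mpr ⟨hR, hC⟩), dif_neg (fun h => h.2 (hS h.1))]

/-- The constant coefficient of the cofactor under a substitution sending the cover cells to `1`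
is nonzero: the covered monomial `m` goes to the nonzero constant `h_m`, and over `ℝ≥0` nothing
cancels it. [folklore] -/
theorem coeff_zero_aeval_ne_zero {τ : Type*} {φ : Fin n × Fin n → MvPolynomial τ ℝ≥0}
    (hφ1 : ∀ v : Fin n × Fin n, v.1 ∈ R ∨ v.2 ∈ C → φ v = 1)
    {h : MvPolynomial (Fin n × Fin n) ℝ≥0} {m : (Fin n × Fin n) →₀ ℕ} (hm : m ∈ h.support)
    (hcov : ∀ v ∈ m.support, v.1 ∈ R ∨ v.2 ∈ C) : coeff 0 (aeval φ h) ≠ 0 := by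
  classical
  have hterm : aeval φ (monomial m (coeff m h)) = MvPolynomial.C (coeff m h) := by
    rw [aeval_monomial, ← C_eq_algebraMap]
    suffices hp : (m.prod fun v k => φ v ^ k) = 1 by rw [hp, mul_one]
    exact Finset.prod_eq_one fun v hv => by
      show φ v ^ (m v) = 1
      rw [hφ1 v (hcov v hv), one_pow]
  have key : coeff m h ≤ coeff 0 (aeval φ h) :=
    calc coeff m h = coeff 0 (aeval φ (monomial m (coeff m h))) := by rw [hterm, coeff_zero_C]
      _ ≤ ∑ d ∈ h.support, coeff 0 (aeval φ (monomial d (coeff d h))) :=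
          Finset.single_le_sum (f := fun d => coeff 0 (aeval φ (monomial d (coeff d h))))
            (fun d _ => zero_le) hm
      _ = coeff 0 (aeval φ h) := by
          conv_rhs => rw [h.as_sum]
          rw [map_sum, coeff_sum]
  exact fun H => (mem_support_iff.mp hm) (le_antisymm (H ▸ key) zero_le)

/-- **The cover rung on the square `Sᶜ`.**  For `R ∪ C ⊆ S`, `|S| = |R| + |C|`, and a monomial
`m` of `h` covered by the rows `R` and the columns `C`: `L(per_{Sᶜ}) ≤ L(per_n · h) + 1` —
the cover substitution `φ` is a projection (free), the bottom homogeneous component of the image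
`|F| · per_{Sᶜ} · h♮` is `|F| h♮(0) · per_{Sᶜ}` (free, `stub_bottomComponentFree`), unscale by
`(|F| · h♮(0))⁻¹` (one gate, `complexity_smul_le`). [folklore] -/
theorem complexity_perPoly_compl_le (hRS : R ⊆ S) (hCS : C ⊆ S) (hcard : S.card = R.card + C.card)
    {h : MvPolynomial (Fin n × Fin n) ℝ≥0} {m : (Fin n × Fin n) →₀ ℕ} (hm : m ∈ h.support)
    (hcov : ∀ v ∈ m.support, v.1 ∈ R ∨ v.2 ∈ C) :
    complexity (perPoly {a : Fin n // a ∉ S} ℝ≥0) ≤ complexity (perPoly (Fin n) ℝ≥0 * h) + 1 := by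
  classical
  -- the cover substitution `φ`, the survivors `G`, the fibre `F`
  obtain ⟨φ, hφ⟩ : ∃ φ : Fin n × Fin n → MvPolynomial ({a : Fin n // a ∉ S} × {a : Fin n // a ∉ S}) ℝ≥0,
      ∀ v, φ v = if v.1 ∈ R ∨ v.2 ∈ C then 1 else
        if h : v.1 ∉ S ∧ v.2 ∉ S then X (⟨v.1, h.1⟩, ⟨v.2, h.2⟩) else 0 := ⟨_, fun v => rfl⟩
  obtain ⟨G, hG⟩ : ∃ G : Finset (Equiv.Perm (Fin n)), ∀ σ, σ ∈ G ↔
      ∀ j, (σ j ∈ R ∨ j ∈ C) ∨ (σ j ∉ S ∧ j ∉ S) :=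
    ⟨Finset.univ.filter fun σ => ∀ j, (σ j ∈ R ∨ j ∈ C) ∨ (σ j ∉ S ∧ j ∉ S), fun σ => by simp⟩
  obtain ⟨F, hF⟩ : ∃ F : Finset (Equiv.Perm (Fin n)), ∀ σ, σ ∈ F ↔
      (∀ j, (σ j ∈ R ∨ j ∈ C) ∨ (σ j ∉ S ∧ j ∉ S)) ∧ ∀ x, x ∉ S → σ x = x :=
    ⟨G.filter fun σ => ∀ x, x ∉ S → σ x = x, fun σ => by simp [hG]⟩
  have hproj : IsProjection (aeval φ (perPoly (Fin n) ℝ≥0 * h)) (perPoly (Fin n) ℝ≥0 * h) := by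
    refine ⟨φ, fun v => ?_, rfl⟩
    rw [hφ]
    by_cases h1 : v.1 ∈ R ∨ v.2 ∈ C
    · exact Or.inr ⟨1, by rw [if_pos h1, C_1]⟩
    by_cases h2 : v.1 ∉ S ∧ v.2 ∉ S
    · exact Or.inl ⟨(⟨v.1, h2.1⟩, ⟨v.2, h2.2⟩), by rw [if_neg h1, dif_pos h2]⟩
    · exact Or.inr ⟨0, by rw [if_neg h1, dif_neg h2, C_0]⟩
  set K : ℝ≥0 := (F.card : ℝ≥0)
  have hK0 : K ≠ 0 := by
    obtain ⟨σ₀, hσ₀⟩ := exists_good_fix hRS hCS hcard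
    exact Nat.cast_ne_zero.mpr (Finset.card_ne_zero.mpr ⟨σ₀, (hF σ₀).mpr hσ₀⟩)
  set c₀ : ℝ≥0 := coeff 0 (aeval φ h)
  have hc₀0 : c₀ ≠ 0 := coeff_zero_aeval_ne_zero (fun v hv => by rw [hφ, if_pos hv]) hm hcov
  set P := aeval φ (perPoly (Fin n) ℝ≥0 * h) with hP
  set δ := Fintype.card {a : Fin n // a ∉ S}
  have hhom : (perPoly {a : Fin n // a ∉ S} ℝ≥0).IsHomogeneous δ := perPoly_isHomogeneous
  have hprod : P = K • (perPoly {a : Fin n // a ∉ S} ℝ≥0 * aeval φ h) := by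
    rw [hP, map_mul, aeval_perPoly_eq_sum hφ hRS hCS hcard hG,
      sum_monomial_shrinkPerm_eq_smul hRS hCS hcard hG hF, smul_mul_assoc]
  -- every monomial of the image has degree `≥ δ`, and its degree-`δ` component is `K c₀ • per_Q`
  have hsupp : ∀ d ∈ P.support,
      δ ≤ Finsupp.weight (1 : {a : Fin n // a ∉ S} × {a : Fin n // a ∉ S} → ℕ) d := fun d hd => by
    rw [hprod] at hd
    exact le_weight_of_mem_support_mul hhom (support_smul hd)
  have hcomp : weightedHomogeneousComponent 1 δ P = (K * c₀) • perPoly {a : Fin n // a ∉ S} ℝ≥0 := by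
    rw [hprod, map_smul]
    change K • homogeneousComponent δ _ = _
    rw [homogeneousComponent_mul_of_isHomogeneous hhom, mul_comm, ← smul_eq_C_mul, smul_smul]
  -- unscale (one gate) ← bottom component (free) ← projection (free)
  calc complexity (perPoly {a : Fin n // a ∉ S} ℝ≥0)
      = complexity ((K * c₀)⁻¹ • weightedHomogeneousComponent 1 δ P) := by
        rw [hcomp, smul_smul, inv_mul_cancel₀ (mul_ne_zero hK0 hc₀0), one_smul]
    _ ≤ complexity (weightedHomogeneousComponent 1 δ P) + 1 := complexity_smul_le_holds _ _
    _ ≤ complexity P + 1 := Nat.add_le_add_right (stub_bottomComponentFree _ P δ hsupp) 1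
    _ ≤ complexity (perPoly (Fin n) ℝ≥0 * h) + 1 :=
        Nat.add_le_add_right (complexity_le_of_isProjection hproj) 1

/-- **stub_coverRung — the COVER RUNG.**  If one monomial `m` of the cofactor `h ≥ 0` is supported
in the union of the rows `R` and the columns `C`, then
`L⁺(per_{n - |R| - |C|}) ≤ L⁺(per_n · h) + 1`: trivial if `|R| + |C| > n` (`per_0 = 1` is free);
otherwise choose `S ⊇ R ∪ C` with `|S| = |R| + |C|`, apply `complexity_perPoly_compl_le` on the
square `Sᶜ` and rename `Sᶜ ≃ Fin (n - |R| - |C|)`. [folklore] -/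
theorem stub_coverRung :
    ∀ (n : ℕ) (h : MvPolynomial (Fin n × Fin n) ℝ≥0) (m : (Fin n × Fin n) →₀ ℕ), m ∈ h.support →
      ∀ (R C : Finset (Fin n)), (∀ v ∈ m.support, v.1 ∈ R ∨ v.2 ∈ C) →
        complexity (perPoly (Fin (n - (R.card + C.card))) ℝ≥0) ≤
          complexity (perPoly (Fin n) ℝ≥0 * h) + 1 := by
  intro n h m hm R C hcov
  classical
  by_cases hn : n < R.card + C.card
  · have h0 : n - (R.card + C.card) = 0 := by omega
    have h1 : perPoly (Fin 0) ℝ≥0 = MvPolynomial.C 1 := by rw [C_1]; exact Matrix.permanent_isEmpty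
    rw [h0, h1, complexity_C_holds]; exact Nat.zero_le _
  push Not at hn
  obtain ⟨S, hRCS, -, hScard⟩ := Finset.exists_subsuperset_card_eq (Finset.subset_univ (R ∪ C))
    (Finset.card_union_le R C) (by rw [Finset.card_univ, Fintype.card_fin]; exact hn)
  have hcardQ : Fintype.card {a : Fin n // a ∉ S} = n - (R.card + C.card) := by
    rw [Fintype.card_subtype_compl, Fintype.card_fin, Fintype.card_coe, hScard]
  have e : {a : Fin n // a ∉ S} ≃ Fin (n - (R.card + C.card)) := Fintype.equivFinOfCardEq hcardQ
  calc complexity (perPoly (Fin (n - (R.card + C.card))) ℝ≥0)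
      = complexity (rename (Prod.map e e) (perPoly {a : Fin n // a ∉ S} ℝ≥0)) := by
        rw [rename_perPoly]
    _ = complexity (perPoly {a : Fin n // a ∉ S} ℝ≥0) :=
        complexity_rename_of_injective_holds (e.injective.prodMap e.injective) _
    _ ≤ complexity (perPoly (Fin n) ℝ≥0 * h) + 1 := complexity_perPoly_compl_le
        (Finset.union_subset_left hRCS) (Finset.union_subset_right hRCS) hScard hm hcov

end Summit.ValiantsHypothesis.ValiantsHypothesis.Theorems.DivisionGap.PerCofactorDegreeReduction.CoverRung

end
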